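import Mathlib
import Literature.MathematicalPhysics.QuantumFieldTheory.BalabanImbrieJaffe1984to88.BIJ85Eq7111EdgeAdjoint

/-!
# `BalabanImbrieJaffe1984to88.BIJ85Eq7116SurfaceAverage` — T. Bałaban, J. Imbrie, A. Jaffe, *Renormalization of the Higgs
model: minimizers, propagators and the stability of mean field theory*, Commun. Math. Phys. **97** (1985) 299–329
[BalabanImbrieJaffe1985]: Sect. 2 p. 304 (2.15)–(2.18)/(2.24) and Sect. 7.1 p. 323 (7.1.16) — **the k-fold surface average
`Q^s_k = (Q^s)^k` on η-lattice bond fields in configuration space on the tori, its adjoint `Q^{s*}_k` ((2.17) composed k times),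
(2.24) `Q^s_kQ^{s*}_k = L^kI = η^{−1}I`, and ITS MOMENTUM SYMBOL `s_μ(p) = e^{i(1−η)p_μ}·Π_{ρ≠μ}v_ρ(p) = u/v̄_μ`** — the weight whose
modulus `|u/v_μ|²` is the `l`-term of (7.1.16) *"a_μ(p′) = ∂^{(1)}_μ(p′)Σ_l(|u/v_μ|²Δ^{−1})(p′+l)"* and which enters p. 323's
*"Q^{e*}_k∂ = ∂Q^{s*}_k"* — PROVED, together with (2.24) in momentum space `Σ_l|s_μ(p′+l)|² = η^{−1}`; file 14 of the (7.1.2) cluster,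
the bond analogue of `BIJ85Eq7111EdgeAverage`/`BIJ85Eq7111EdgeAdjoint` (plaquettes)

statement-level skeleton of published theorems with citation tags; proofs where landed; nothing here is a claim about
the Yang–Mills mass gap

PDF held: `paper:balaban1985-cmp97-bij-higgs-minimizers` (journal page = PDF page + 298).  Text read as images: PDF p. 6 (journal
304; `run/shared/lean/pub/lit-balaban/lit-balaban-r15/pages/1985-cmp97-bij-higgs-minimizers-p006-x2.png`), PDF p. 7 (journal 305),
PDF p. 25 (journal 323; `run/shared/lean/pub/pub-balaban/t4/b2b-balaban-t4-lit2/renders/bij1985/1985-cmp97-bij-higgs-minimizers-p025-x2.png`).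

CITATION HEADER (lean-in-tree rule).  Part of the lit-balaban TYPED SKELETON (HOME `run/shared/lean/pub/lit-balaban/`); WHAT IS
REPRODUCED: rows **C1.Eq2.15 … C1.Eq2.18**, **C1.Eq2.24** (surface member) and the weight of **(7.1.16)** in row **C1.Eq7.1.13-7.1.19**
(p. 304 [PDF 6], verbatim: *"Define the set of surface bonds B^s(b′) for an L-lattice bond b′ as follows: B^s(b′) = {b : b = (b₋,b₊),
b₋ ∈ B(b′₋), b₊ ∈ B(b′₊)} (2.15) (see Fig. 1). Associated with the surface is the average (Q^sA)_{b′} = L^{−(d−1)}Σ_{b∈B^s(b′)}A_b.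
(2.16) Then (Q^{s*}A)_b = LA_{b′} if b ∈ B^s(b′), 0 otherwise, (2.17) using the inner product (2.14). Also Q^sQ^{s*} = LI,
Q^{s*}Q^s = LP^s, (2.18)"*; p. 305 (2.24) *"Q^s_kQ^{s*}_k = L^kI = η^{−1}I"*; p. 323 [PDF 25] (7.1.16)), `HOME/lit-balaban-r15/ROWS-C1*.md`
(owner r15, referee ref-5; r15's `BIJ85Sect2SurfaceAverages` types (2.15)–(2.18) over an abstract two-scale bond geometry, seat
p19/p31's `BIJ85CurlQsstar`/`BIJ85Eq224Proof` prove them on the `Setup` tori — this file is the `Tor`-carrier model matching the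
Fourier calculus of `BIJ85Eq7111CrossSymbols`).  TYPED READING: as in `BIJ85Eq7111EdgeAverage`; composing (2.15)/(2.16) k times, the
k-fold surface set of the unit bond `⟨y, y+e_μ⟩` consists of the η-bonds `⟨x, x+ηe_μ⟩` with `x = n·y + j`, `j_μ = n − 1` (the last
fine layer, `x + ηe_μ ∈ B^k(y+e_μ)`) and `j_ρ` free for `ρ ≠ μ` (`surfOffsets`; `n^{d−1}` bonds), `(Q^s_kA)_μ(y) =
η^{d−1}Σ_{x}A_μ(x)` (`surfAvgC`); `Q^{s*}_k = η^{−d}(Q^s_k)ᴴ` for the weighted products (2.14) (`surfAdjC`).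
WHAT IS KERNEL-CHECKED (zero `sorry`, standard axioms): `surfAvgC_mulVec`, `isCrossTI_surfAvgC`, the symbol **`symbX_surfAvgC_pOf`**
`= δ·s_μ` with **`surfW_eq`** `s_μ = ω_μ^{n−1}Π_{ρ≠μ}v_ρ`, **`surfW_mul_conj_vSym`** `s_μ·v̄_μ = u` (so `s_μ = u/v̄_μ`; the printed
modulus `|u/v_μ|` of (7.1.16): `norm_surfW_mul`), `dft_surfAvgC` (`(Q^s_kA)^_μ(p′) = cΣ_l s_μ(p′+l)Â_μ(p′+l)`); `surfAvgC_apply_bpt`,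
`card_surfOffsets`, **(2.17)_k `surfAdjC_mulVec`** (`(Q^{s*}_kB)_μ(n·y+j) = η^{−1}B_μ(y)` if `j_μ = n−1`, else `0`), `inner_surfAvgC`,
**(2.24) `surfAvgC_surfAdjC_mulVec`** (`Q^s_kQ^{s*}_k = η^{−1}I`) and `sum_normSq_surfW` (`Σ_l|s_μ(p′+l)|² = n`).  NOT CLAIMED:
`Q^{s*}_kQ^s_k = η^{−1}P^s_k`; the bond average Q (2.13) (pub-balaban `B5Block118.QvOp` is [6I] (1.18)).  Unit `lit-balaban-p27` (gen 5).
-/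

namespace Literature.MathematicalPhysics.QuantumFieldTheory.BalabanImbrieJaffe1984to88.BIJ85Eq7116SurfaceAverage

open scoped BigOperators Matrix ComplexConjugate
open Finset Complex
open Literature.MathematicalPhysics.QuantumFieldTheory.Balaban1983to89
open Literature.MathematicalPhysics.QuantumFieldTheory.Balaban1983to89.B5Prop11Plancherel
open Literature.MathematicalPhysics.QuantumFieldTheory.Balaban1983to89.B5Prop11Fiber
open Literature.MathematicalPhysics.QuantumFieldTheory.Balaban1983to89.B5Block118
open Literature.MathematicalPhysics.QuantumFieldTheory.Balaban1983to89.B5Blocks16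
open Literature.MathematicalPhysics.QuantumFieldTheory.BalabanImbrieJaffe1984to88.BIJ85Eq712Plancherel
open Literature.MathematicalPhysics.QuantumFieldTheory.BalabanImbrieJaffe1984to88.BIJ85Eq712SymbolCalculus
open Literature.MathematicalPhysics.QuantumFieldTheory.BalabanImbrieJaffe1984to88.BIJ85Eq7111CrossSymbols
open Literature.MathematicalPhysics.QuantumFieldTheory.BalabanImbrieJaffe1984to88.BIJ85Eq7111EdgeAverage
open Literature.MathematicalPhysics.QuantumFieldTheory.BalabanImbrieJaffe1984to88.BIJ85Eq7111EdgeAdjoint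

noncomputable section

variable {d : ℕ} (n : ℕ) [NeZero n] (M : Fin d → ℕ) [hM : ∀ μ, NeZero (M μ)]

/-! ## §1 The k-fold surface bonds `B^s_k(⟨y, y+e_μ⟩)` and the surface average `Q^s_k` -/

/-- the admissible offsets per direction of a k-fold surface bond in direction `μ`: `n − 1` in direction `μ` (so that `b₊ = x + ηe_μ`
lies in the next block), anything in the other directions. [cite: BalabanImbrieJaffe1985, (2.15) p.304] -/
def surfSlots (μ ρ : Fin d) : Finset (Fin n) := if ρ = μ then {topIdx n} else Finset.univ

/-- **The k-fold surface set `B^s_k(⟨y, y+e_μ⟩)`** as offsets `j` in the block `B^k(y)`: *"B^s(b′) = {b : b₋ ∈ B(b′₋), b₊ ∈ B(b′₊)}"*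
(2.15) composed k times — the η-bonds `⟨n·y + j, n·y + j + ηe_μ⟩` with `j_μ = n − 1`. [cite: BalabanImbrieJaffe1985, (2.15) p.304] -/
def surfOffsets (μ : Fin d) : Finset (Fin d → Fin n) := Fintype.piFinset (surfSlots n μ)

/-- `j ∈ B^s_k(μ)` iff `j_μ = n − 1`. [cite: BalabanImbrieJaffe1985, (2.15) p.304] -/
theorem mem_surfOffsets {μ : Fin d} {j : Fin d → Fin n} : j ∈ surfOffsets n μ ↔ j μ = topIdx n := by
  simp only [surfOffsets, Fintype.mem_piFinset, surfSlots]
  constructor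
  · intro h
    have hμ := h μ
    rwa [if_pos rfl, Finset.mem_singleton] at hμ
  · intro hμ ρ
    split_ifs with h
    · subst h; rw [Finset.mem_singleton]; exact hμ
    · exact Finset.mem_univ _

/-- `|B^s_k(⟨y,y+e_μ⟩)| = n^{d−1}` (*"L^{−(d−1)}Σ"* = average). [cite: BalabanImbrieJaffe1985, (2.16) p.304] -/
theorem card_surfOffsets (μ : Fin d) : (surfOffsets n μ).card = n ^ (d - 1) := by
  rw [surfOffsets, Fintype.card_piFinset]
  have h1 : ∀ ρ, (surfSlots n μ ρ).card = if ρ = μ then 1 else n := by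
    intro ρ
    unfold surfSlots
    split_ifs
    · rw [Finset.card_singleton]
    · rw [Finset.card_univ, Fintype.card_fin]
  simp_rw [h1]
  rw [Finset.prod_ite, Finset.prod_const_one, one_mul, Finset.prod_const]
  congr 1
  have h2 : (Finset.univ.filter fun ρ : Fin d => ¬ρ = μ) = Finset.univ.erase μ := by
    ext ρ
    simp only [Finset.mem_filter, Finset.mem_univ, true_and, Finset.mem_erase, and_true]
  rw [h2, Finset.card_erase_of_mem (Finset.mem_univ μ), Finset.card_univ, Fintype.card_fin]

/-- **The k-fold surface average `Q^s_k = (Q^s)^k`** from η-bond fields to unit bond fields: `(Q^s_kA)_μ(y) = η^{d−1}Σ_{x ∈ B^s_k} A_μ(x)`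
((2.16) composed k times; diagonal in the direction). [cite: BalabanImbrieJaffe1985, (2.16) p.304] -/
def surfAvgC : Matrix (Tor M × Fin d) (Tor (fine n M) × Fin d) ℂ :=
  Matrix.of fun a b => if b.2 = a.2 then
    ∑ j ∈ surfOffsets n a.2, (if b.1 = bpt n M a.1 j then (((n : ℂ) ^ (d - 1))⁻¹) else 0) else 0

/-- `(Q^s_kA)_μ(y) = η^{d−1}Σ_{j ∈ B^s_k(μ)} A_μ(n·y + j)`. [cite: BalabanImbrieJaffe1985, (2.16) p.304] -/
theorem surfAvgC_mulVec (A : Tor (fine n M) × Fin d → ℂ) (y : Tor M) (μ : Fin d) :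
    (surfAvgC n M *ᵥ A) (y, μ) = ((n : ℂ) ^ (d - 1))⁻¹ * ∑ j ∈ surfOffsets n μ, A (bpt n M y j, μ) := by
  simp only [Matrix.mulVec, dotProduct, surfAvgC, Matrix.of_apply]
  rw [Fintype.sum_prod_type]
  have h1 : ∀ x : Tor (fine n M), ∑ b : Fin d,
      (if b = μ then ∑ j ∈ surfOffsets n μ, (if x = bpt n M y j then (((n : ℂ) ^ (d - 1))⁻¹) else 0) else 0) * A (x, b)
      = ∑ j ∈ surfOffsets n μ, (if x = bpt n M y j then (((n : ℂ) ^ (d - 1))⁻¹) else 0) * A (x, μ) := by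
    intro x
    rw [Finset.sum_eq_single μ]
    · rw [if_pos rfl, Finset.sum_mul]
    · intro b _ hb
      rw [if_neg hb, zero_mul]
    · exact fun h => absurd (Finset.mem_univ _) h
  simp_rw [h1]
  rw [Finset.sum_comm, Finset.mul_sum]
  refine Finset.sum_congr rfl fun j _ => ?_
  simp only [ite_mul, zero_mul, Finset.sum_ite_eq', Finset.mem_univ, if_true]

omit hM in
/-- `Q^s_k` is translation invariant under the unit-lattice translations. [cite: BalabanImbrieJaffe1985, (2.16) p.304] -/
theorem isCrossTI_surfAvgC : IsCrossTI n M (Fin d) (Fin d) (surfAvgC n M) := by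
  intro a y x i j
  simp only [surfAvgC, Matrix.of_apply, bpt_add, add_left_inj]

/-- The kernel of `Q^s_k` on block coordinates: `η^{d−1}` iff the directions agree, `y = y′` and `j ∈ B^s_k(μ′)`.
[cite: BalabanImbrieJaffe1985, (2.16) p.304] -/
theorem surfAvgC_apply_bpt (y' : Tor M) (μ' : Fin d) (y : Tor M) (j : Fin d → Fin n) (μ : Fin d) :
    surfAvgC n M (y', μ') (bpt n M y j, μ)
      = if μ = μ' ∧ y = y' ∧ j ∈ surfOffsets n μ' then (((n : ℂ) ^ (d - 1))⁻¹) else 0 := by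
  simp only [surfAvgC, Matrix.of_apply]
  by_cases hμ : μ = μ'
  · rw [if_pos hμ]
    have hiff : ∀ j' : Fin d → Fin n, bpt n M y j = bpt n M y' j' ↔ y = y' ∧ j = j' := by
      intro j'
      constructor
      · intro h
        have h2 := bpt_injective n M (a₁ := (y, j)) (a₂ := (y', j')) h
        exact ⟨(Prod.mk.inj h2).1, (Prod.mk.inj h2).2⟩
      · exact fun h => by rw [h.1, h.2]
    simp_rw [hiff]
    by_cases hy : y = y'
    · subst hy
      simp [Finset.sum_ite_eq, hμ]
    · rw [if_neg (fun h => hy h.2.1)]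
      exact Finset.sum_eq_zero fun j' _ => if_neg (fun h => hy h.1)
  · rw [if_neg hμ, if_neg (fun h => hμ h.1)]

/-! ## §2 The symbol `s_μ = e^{i(1−η)p_μ}Π_{ρ≠μ}v_ρ = u/v̄_μ` of `Q^s_k` -/

/-- The weight of `Q^s_k` in momentum space at `p = p′ + l ↔ (k, q)`: `s_μ(p) = η^{d−1}Π_ρΣ_{t∈slots_ρ}ω_ρ^t`.
[cite: BalabanImbrieJaffe1985, (7.1.16) p.323] -/
def surfW (k : Fin d → Fin n) (s : Fin d → ℝ) (μ : Fin d) : ℂ :=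
  ((n : ℂ) ^ (d - 1))⁻¹ * ∏ ρ, ∑ t ∈ surfSlots n μ ρ, om n k s ρ ^ (t : ℕ)

/-- The symbol of `Q^s_k` at a fine momentum `p`: diagonal in the direction, `η^{d−1}Σ_{j∈B^s_k(μ)}e^{ip·ηj}`.
[cite: BalabanImbrieJaffe1985, (7.1.16) p.323] -/
theorem symbX_surfAvgC (p : Tor (fine n M)) (μ μ' : Fin d) :
    symbX n M (Fin d) (Fin d) (surfAvgC n M) p μ μ'
      = if μ' = μ then ((n : ℂ) ^ (d - 1))⁻¹ * ∑ j ∈ surfOffsets n μ, chi (fine n M) p (iota n M j) else 0 := by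
  rw [symbX_apply]
  simp only [surfAvgC, Matrix.of_apply]
  split_ifs with h
  · simp_rw [Finset.sum_mul, ite_mul, zero_mul]
    rw [Finset.sum_comm, Finset.mul_sum]
    refine Finset.sum_congr rfl fun j _ => ?_
    rw [Finset.sum_ite_eq' Finset.univ (bpt n M 0 j), if_pos (Finset.mem_univ _), bpt_zero]
  · simp only [zero_mul, Finset.sum_const_zero]

/-- **The symbol of `Q^s_k` at `p = p′ + l`**: `σ_{Q^s_k}(p′+l)_{μμ′} = δ_{μμ′}·s_μ(p′+l)`. [cite: BalabanImbrieJaffe1985, (7.1.16) p.323] -/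
theorem symbX_surfAvgC_pOf (k : Fin d → Fin n) (q : Tor M) (μ μ' : Fin d) :
    symbX n M (Fin d) (Fin d) (surfAvgC n M) (pOf n M (k, q)) μ μ' = if μ' = μ then surfW n k (sOf M q) μ else 0 := by
  rw [symbX_surfAvgC]
  split_ifs with h
  · rw [surfW, surfOffsets]
    simp_rw [chi_pOf_iota]
    rw [← Finset.prod_univ_sum (surfSlots n μ) (fun ρ (t : Fin n) => om n k (sOf M q) ρ ^ (t : ℕ))]
  · rfl

omit hM in
/-- **The closed form** `s_μ(p) = ω_μ^{n−1}·Π_{ρ≠μ}v_ρ(p)` — the (d−1)-dimensional face average `Π_{ρ≠μ}v_ρ = u/v_μ` (the modulus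
printed in (7.1.16)) times the phase `e^{i(1−η)p_μ}` of the last fine layer. [cite: BalabanImbrieJaffe1985, (7.1.16) p.323] -/
theorem surfW_eq (k : Fin d → Fin n) (q : Tor M) (μ : Fin d) :
    surfW n k (sOf M q) μ = om n k (sOf M q) μ ^ (n - 1) * ∏ ρ ∈ Finset.univ.erase μ, vSym n k (sOf M q) ρ := by
  have hn : (n : ℂ) ≠ 0 := by exact_mod_cast NeZero.ne n
  have hrest : ∀ ρ ∈ Finset.univ.erase μ,
      ∑ t ∈ surfSlots n μ ρ, om n k (sOf M q) ρ ^ (t : ℕ) = (n : ℂ) * vSym n k (sOf M q) ρ := by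
    intro ρ hρ
    rw [surfSlots, if_neg (Finset.mem_erase.mp hρ).1, avg_om]
  have hcard : (Finset.univ.erase μ).card = d - 1 := by
    rw [Finset.card_erase_of_mem (Finset.mem_univ μ), Finset.card_univ, Fintype.card_fin]
  rw [surfW, ← Finset.mul_prod_erase _ _ (Finset.mem_univ μ), Finset.prod_congr rfl hrest, Finset.prod_mul_distrib,
    Finset.prod_const, hcard, surfSlots, if_pos rfl, Finset.sum_singleton]
  show ((n : ℂ) ^ (d - 1))⁻¹ * (om n k (sOf M q) μ ^ ((topIdx n : Fin n) : ℕ) * ((n : ℂ) ^ (d - 1) * _)) = _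
  have ht : ((topIdx n : Fin n) : ℕ) = n - 1 := rfl
  rw [ht]
  field_simp

omit [NeZero n] in
/-- kernel: `v_μΠ_{ρ≠μ}v_ρ = u`. [cite: BalabanImbrieJaffe1985, (7.1.9) p.322] -/
private theorem vSym_mul_prod (k : Fin d → Fin n) (s : Fin d → ℝ) (μ : Fin d) :
    vSym n k s μ * ∏ ρ ∈ Finset.univ.erase μ, vSym n k s ρ = uSym n k s := by
  rw [uSym, ← Finset.mul_prod_erase _ _ (Finset.mem_univ μ)]

omit hM in
/-- **`s_μ·v̄_μ = u`** (division-free `s_μ = u/v̄_μ`): the configuration-space surface weight versus the phase-blind modulus `|u/v_μ|` of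
(7.1.16). [cite: BalabanImbrieJaffe1985, (7.1.16) p.323] -/
theorem surfW_mul_conj_vSym (k : Fin d → Fin n) (q : Tor M) (μ : Fin d) :
    surfW n k (sOf M q) μ * conj (vSym n k (sOf M q) μ) = uSym n k (sOf M q) := by
  rw [surfW_eq, ← vSym_mul_prod n k (sOf M q) μ]
  have h := om_pow_mul_conj_vSym n M k q μ
  calc om n k (sOf M q) μ ^ (n - 1) * (∏ ρ ∈ Finset.univ.erase μ, vSym n k (sOf M q) ρ) * conj (vSym n k (sOf M q) μ)
      = (om n k (sOf M q) μ ^ (n - 1) * conj (vSym n k (sOf M q) μ)) * ∏ ρ ∈ Finset.univ.erase μ, vSym n k (sOf M q) ρ := by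
        ring
    _ = vSym n k (sOf M q) μ * ∏ ρ ∈ Finset.univ.erase μ, vSym n k (sOf M q) ρ := by rw [h]

omit hM in
/-- `|s_μ(p)| = Π_{ρ≠μ}|v_ρ(p)|`. [cite: BalabanImbrieJaffe1985, (7.1.16) p.323] -/
theorem norm_surfW (k : Fin d → Fin n) (q : Tor M) (μ : Fin d) :
    ‖surfW n k (sOf M q) μ‖ = ∏ ρ ∈ Finset.univ.erase μ, ‖vSym n k (sOf M q) ρ‖ := by
  rw [surfW_eq, norm_mul, norm_pow, norm_om, one_pow, one_mul, Complex.norm_prod]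

omit hM in
/-- `|s_μ|·|v_μ| = |u|` — the modulus `|u/v_μ|` whose square is the `l`-term weight of (7.1.16). [cite: BalabanImbrieJaffe1985, (7.1.16) p.323] -/
theorem norm_surfW_mul (k : Fin d → Fin n) (q : Tor M) (μ : Fin d) :
    ‖surfW n k (sOf M q) μ‖ * ‖vSym n k (sOf M q) μ‖ = ‖uSym n k (sOf M q)‖ := by
  rw [← surfW_mul_conj_vSym n M k q μ, norm_mul, Complex.norm_conj]

/-- **The momentum representation of `Q^s_k`**: `(Q^s_kA)^_μ(p′) = c·Σ_l s_μ(p′+l)Â_μ(p′+l)` (shape of (7.1.11), bond version; `c = n^{−d/2}`).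
[cite: BalabanImbrieJaffe1985, (7.1.11) p.322] -/
theorem dft_surfAvgC (A : Tor (fine n M) × Fin d → ℂ) (q : Tor M) (μ : Fin d) :
    (dftC M (Fin d) *ᵥ (surfAvgC n M *ᵥ A)) (q, μ)
      = (cQ n M : ℂ) * ∑ k : Fin d → Fin n, surfW n k (sOf M q) μ * (dftC (fine n M) (Fin d) *ᵥ A) (pOf n M (k, q), μ) := by
  rw [dftC_mulVec_cross n M (Fin d) (Fin d) (isCrossTI_surfAvgC n M) A q μ]
  congr 1
  refine Finset.sum_congr rfl fun k _ => ?_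
  rw [Finset.sum_eq_single μ]
  · rw [symbX_surfAvgC_pOf, if_pos rfl]
  · intro μ' _ hb
    rw [symbX_surfAvgC_pOf, if_neg hb, zero_mul]
  · exact fun h => absurd (Finset.mem_univ _) h

/-! ## §3 `Q^{s*}_k` ((2.17) composed k times) and (2.24) `Q^s_kQ^{s*}_k = η^{−1}I` -/

/-- **`Q^{s*}_k`** — the adjoint of `Q^s_k` for the weighted products (2.14) (`η^dΣ` on η-bonds, `Σ` on unit bonds): `η^{−d}(Q^s_k)ᴴ`.
[cite: BalabanImbrieJaffe1985, (2.17) p.304] -/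
def surfAdjC : Matrix (Tor (fine n M) × Fin d) (Tor M × Fin d) ℂ :=
  ((n : ℂ) ^ d) • (surfAvgC n M)ᴴ

/-- adjointness for (2.14): `⟨B, Q^s_kA⟩_1 = ⟨Q^{s*}_kB, A⟩_η`. [cite: BalabanImbrieJaffe1985, (2.14) p.304] -/
theorem inner_surfAvgC (B : Tor M × Fin d → ℂ) (A : Tor (fine n M) × Fin d → ℂ) :
    star B ⬝ᵥ (surfAvgC n M *ᵥ A) = (((n : ℂ) ^ d)⁻¹) * (star (surfAdjC n M *ᵥ B) ⬝ᵥ A) := by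
  have hn : ((n : ℂ) ^ d) ≠ 0 := pow_ne_zero _ (by exact_mod_cast NeZero.ne n)
  rw [surfAdjC, Matrix.smul_mulVec, star_smul, Matrix.star_mulVec, Matrix.conjTranspose_conjTranspose,
    smul_dotProduct, ← Matrix.dotProduct_mulVec, smul_eq_mul, ← mul_assoc]
  rw [Complex.star_def, ← Complex.ofReal_natCast, ← Complex.ofReal_pow, Complex.conj_ofReal, Complex.ofReal_pow,
    Complex.ofReal_natCast, inv_mul_cancel₀ hn, one_mul]

omit hM in
/-- kernel: `η^{−d}·η^{d−1} = η^{−1}`: `n^d·(n^{d−1})^{−1} = n` (`1 ≤ d`). [cite: BalabanImbrieJaffe1985, (2.24) p.305] -/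
theorem natCast_pow_mul_inv_pred (hd : 1 ≤ d) : (n : ℂ) ^ d * ((n : ℂ) ^ (d - 1))⁻¹ = (n : ℂ) := by
  have hn : (n : ℂ) ≠ 0 := by exact_mod_cast NeZero.ne n
  have h : (n : ℂ) ^ d = (n : ℂ) ^ (d - 1) * (n : ℂ) := by rw [← pow_succ, Nat.sub_add_cancel hd]
  rw [h, mul_comm, ← mul_assoc, inv_mul_cancel₀ (pow_ne_zero _ hn), one_mul]

/-- **(2.17) composed k times**, *"(Q^{s*}A)_b = LA_{b′} if b ∈ B^s(b′), 0 otherwise"*: `(Q^{s*}_kB)_μ(n·y + j) = η^{−1}B_μ(y)` if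
`j_μ = n − 1` (the bond crosses into `B^k(y+e_μ)`), `0` otherwise (`η^{−1} = n = L^k`). [cite: BalabanImbrieJaffe1985, (2.17) p.304] -/
theorem surfAdjC_mulVec (B : Tor M × Fin d → ℂ) (y : Tor M) (j : Fin d → Fin n) (μ : Fin d) :
    (surfAdjC n M *ᵥ B) (bpt n M y j, μ) = if j ∈ surfOffsets n μ then (n : ℂ) * B (y, μ) else 0 := by
  have hd : 1 ≤ d := Nat.one_le_of_lt μ.pos
  rw [surfAdjC, Matrix.smul_mulVec, Pi.smul_apply, smul_eq_mul, Matrix.mulVec, dotProduct, Fintype.sum_prod_type,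
    Finset.sum_eq_single y]
  · rw [Finset.sum_eq_single μ]
    · rw [Matrix.conjTranspose_apply, surfAvgC_apply_bpt]
      simp only [true_and]
      split_ifs with hj
      · rw [Complex.star_def, map_inv₀, map_pow, Complex.conj_natCast, ← mul_assoc, natCast_pow_mul_inv_pred n hd]
      · rw [star_zero, zero_mul, mul_zero]
    · intro a _ ha
      rw [Matrix.conjTranspose_apply, surfAvgC_apply_bpt, if_neg (fun h => ha h.1.symm), star_zero, zero_mul]
    · exact fun h => absurd (Finset.mem_univ _) h
  · intro y' _ hy'
    refine Finset.sum_eq_zero fun a _ => ?_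
    rw [Matrix.conjTranspose_apply, surfAvgC_apply_bpt, if_neg (fun h => hy' h.2.1.symm), star_zero, zero_mul]
  · exact fun h => absurd (Finset.mem_univ _) h

/-- **(2.24), surface member** p. 305, *"Q^s_kQ^{s*}_k = L^kI = η^{−1}I"* — PROVED for the configuration-space operator:
`(Q^s_kQ^{s*}_kB)_μ(y) = n·B_μ(y)`. [cite: BalabanImbrieJaffe1985, (2.24) p.305] -/
theorem surfAvgC_surfAdjC_mulVec (B : Tor M × Fin d → ℂ) (y : Tor M) (μ : Fin d) :
    (surfAvgC n M *ᵥ (surfAdjC n M *ᵥ B)) (y, μ) = (n : ℂ) * B (y, μ) := by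
  have hn : ((n : ℂ) ^ (d - 1)) ≠ 0 := pow_ne_zero _ (by exact_mod_cast NeZero.ne n)
  rw [surfAvgC_mulVec]
  have h1 : ∀ j ∈ surfOffsets n μ, (surfAdjC n M *ᵥ B) (bpt n M y j, μ) = (n : ℂ) * B (y, μ) := by
    intro j hj
    rw [surfAdjC_mulVec, if_pos hj]
  rw [Finset.sum_congr rfl h1, Finset.sum_const, card_surfOffsets, nsmul_eq_mul]
  push_cast
  field_simp

/-- (2.24) surface member, entrywise: `(Q^s_kQ^{s*}_k)((y,μ),(y′,μ′)) = n·δ`. [cite: BalabanImbrieJaffe1985, (2.24) p.305] -/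
theorem surfAvgC_mul_surfAdjC_apply (y y' : Tor M) (μ μ' : Fin d) :
    (surfAvgC n M * surfAdjC n M) (y, μ) (y', μ') = if (y, μ) = (y', μ') then (n : ℂ) else 0 := by
  have h : (surfAvgC n M * surfAdjC n M) (y, μ) (y', μ')
      = (surfAvgC n M *ᵥ (surfAdjC n M *ᵥ (Pi.single (y', μ') (1 : ℂ)))) (y, μ) := by
    rw [Matrix.mulVec_mulVec, Matrix.mulVec_single_one]
    rfl
  rw [h, surfAvgC_surfAdjC_mulVec, Pi.single_apply]
  split_ifs <;> simp

/-- `Q^s_kQ^{s*}_k = η^{−1}I` as a matrix identity. [cite: BalabanImbrieJaffe1985, (2.24) p.305] -/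
theorem surfAvgC_mul_surfAdjC : surfAvgC n M * surfAdjC n M = (n : ℂ) • (1 : Matrix (Tor M × Fin d) (Tor M × Fin d) ℂ) := by
  ext ⟨y, μ⟩ ⟨y', μ'⟩
  rw [surfAvgC_mul_surfAdjC_apply, Matrix.smul_apply, Matrix.one_apply, smul_eq_mul, mul_ite, mul_one, mul_zero]

/-! ## §4 (2.24) in momentum space: `Σ_l |s_μ(p′+l)|² = n = η^{−1}` -/

/-- **(2.24) in momentum space**: `Σ_l|s_μ(p′+l)|² = n = η^{−1}` — with `|s_μ| = Π_{ρ≠μ}|v_ρ|` the product of the one-dimensional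
averaging identities `Σ_{l_ρ}|v_ρ(p′+l)|² = 1` over `ρ ≠ μ` (times the `n` values of `l_μ`). [cite: BalabanImbrieJaffe1985, (2.24) p.305] -/
theorem sum_normSq_surfW (q : Tor M) (μ : Fin d) :
    ∑ k : Fin d → Fin n, ‖surfW n k (sOf M q) μ‖ ^ 2 = (n : ℝ) := by
  have hn : ((n : ℂ) ^ d) ≠ 0 := pow_ne_zero _ (by exact_mod_cast NeZero.ne n)
  -- the symbol of `Q^s_kQ^{s*}_k` at `p′`, entry `μμ`, two ways
  have hconf : symbR M (Fin d) (Fin d) (surfAvgC n M * surfAdjC n M) q μ μ = (n : ℂ) := by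
    rw [surfAvgC_mul_surfAdjC, symbR_smul, symbR_one, Matrix.smul_apply, Matrix.one_apply_eq, smul_eq_mul, mul_one]
  have hmom : symbR M (Fin d) (Fin d) (surfAvgC n M * surfAdjC n M) q μ μ
      = ∑ k : Fin d → Fin n, surfW n k (sOf M q) μ * conj (surfW n k (sOf M q) μ) := by
    rw [surfAdjC, Matrix.mul_smul, symbR_smul,
      symb_mul_conjTranspose n M (Fin d) (Fin d) (Fin d) (isCrossTI_surfAvgC n M) (isCrossTI_surfAvgC n M) q,
      smul_smul, cQ_sq, mul_inv_cancel₀ hn, one_smul, Matrix.sum_apply]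
    refine Finset.sum_congr rfl fun k _ => ?_
    rw [Matrix.mul_apply, Finset.sum_eq_single μ]
    · rw [Matrix.conjTranspose_apply, symbX_surfAvgC_pOf, if_pos rfl, Complex.star_def]
    · intro μ' _ hb
      rw [symbX_surfAvgC_pOf, if_neg hb, zero_mul]
    · exact fun h => absurd (Finset.mem_univ _) h
  have h := hmom.symm.trans hconf
  simp_rw [Complex.mul_conj'] at h
  exact_mod_cast h

end

end Literature.MathematicalPhysics.QuantumFieldTheory.BalabanImbrieJaffe1984to88.BIJ85Eq7116SurfaceAverage
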